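import Literature.Algebra.EuclideanLattices.RegevRoutineFibres
import Literature.Algebra.EuclideanLattices.RegevUSVPInput
import HarnessLib

/-!
# Regev's reduction `uSVP ≤ DCP`: the good data and the per-copy success bound

Eighteenth file (XIV-f) of the construction discharging `usvp_of_dihedralCoset` (Regev 2004,
Thm. 1.1). For the parameter set `prePar FD pD pr` of a DCP solver family `FD` (width bound `pD`,
register bound `pr`, `κ`-field `L²`, guess zone `3L + rmax`), an LLL-reduced `c(f) n^{1/2+2f}`-unique
instance `I` at a dimension where the eventual inequalities of file XIV-a hold, and the data of
file XIV-b, we build **the good data of file XII** on the input `xOf f I` of file XIV-c — the right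
guesses `(ρ₀, m, i₀, r)` and Regev's fibre hypotheses transported along `nOf L = n` — and derive,
by files VII and XII, **the per-copy success bound**: the routine outputs a good guess pattern and
the DCP shift `d₀` with probability at least `2^{-wTot} q ≥ q / 2^{4L + rmax L}` whenever the solver
succeeds with probability `q` on admissible inputs (`kernelProb_routine_ge`).

## References

* O. Regev, *Quantum computation and lattice problems*, SIAM J. Comput. 33 (2004), proof of
  Lemma 3.12 (pp. 14–15) and of Thm. 1.1 (p. 7).
-/

noncomputable section

namespace Literature.Algebra.EuclideanLattices

namespace RegevRoutine

open _root_.Computability Literature.Computability.Complexity Literature.Computability.Cryptography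
  Literature.Computability.QuantumComplexity Regev2004 Finset Polynomial DCP

/-! ### The parameter set of a solver -/

/-- **The parameter set** of a DCP solver family: its width bound, the register bound, the
`κ`-field `L²` and the guess zone `3L + rmax L`. [cite: Regev2004, Lemma 3.12 (proof, p. 14)] -/
def prePar (FD : QCircuitFamily cliffordT) (pD : Polynomial ℕ) (hpD : ∀ ℓ, ℓ + FD.ancillas ℓ ≤ pD.eval ℓ) (pr : Polynomial ℕ) :
    PreParams :=
  ⟨FD, pD, hpD, pr, X * X, C 3 * X + (pr.comp ellPoly + 1)⟩

section Good

variable {f : ℝ} {I : LatticeInstance} (FD : QCircuitFamily cliffordT) (pD : Polynomial ℕ)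
  (hpD : ∀ ℓ, ℓ + FD.ancillas ℓ ≤ pD.eval ℓ) (pr : Polynomial ℕ)

/-- `kap = L²` for the parameter set. [folklore] -/
theorem kap_prePar (L : ℕ) : kap (mkParams (prePar FD pD hpD pr)) L = L * L := by
  change (X * X : Polynomial ℕ).eval L = L * L; simp

/-- `gam = 3L + rmax L` for the parameter set. [folklore] -/
theorem gam_prePar (L : ℕ) : gam (mkParams (prePar FD pD hpD pr)) L = 3 * L + rmax (mkParams (prePar FD pD hpD pr)) L := by
  change (C 3 * X + (pr.comp ellPoly + 1) : Polynomial ℕ).eval L = 3 * L + (pr.eval (ell L) + 1)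
  simp [eval_comp]

/-- `rmax = pr (ell L) + 1` for the parameter set. [folklore] -/
theorem rmax_prePar (L : ℕ) : rmax (mkParams (prePar FD pD hpD pr)) L = pr.eval (ell L) + 1 := rfl

variable (f I)

/-- **The basis of the routine**: `2ⁿ B`, reindexed along `nOf |x| = n`. [folklore] -/
def basisX : Matrix (Fin (nOf (xOf f I).length)) (Fin (nOf (xOf f I).length)) ℤ := reidx nOf_length_xOf (Jof I).basis

/-- **The right guesses** `(ρ₀, m, i₀, r)`. [cite: Regev2004, Thm. 1.1 (proof, p. 7) and Lemma 3.12 (the number of registers)] -/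
def guessRight (D : InstData I) (r' : ℕ) : Guess := ⟨Regev2004.rhoOf f I, (D.m f).toNat, D.i0, r'⟩

variable {f I FD pD hpD pr}

/-- `(m.toNat : ℤ) = m`. [folklore] -/
theorem cast_m_toNat (D : InstData I) : (((D.m f).toNat : ℕ) : ℤ) = D.m f := Int.toNat_of_nonneg (D.m_pos f).le

/-- `i₀ < nOf |x|`. [folklore] -/
theorem i0_lt (D : InstData I) (r' : ℕ) : (guessRight f I D r').i0 < nOf (xOf f I).length := by
  rw [nOf_length_xOf]; exact D.i0.isLt

/-- The coefficient vector, reindexed. [folklore] -/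
def uX (D : InstData I) : Fin (nOf (xOf f I).length) → ℤ := fun i => D.u (i.cast nOf_length_xOf)

/-- **The index coins fit into the `κ`-field** of the parameter set. [folklore] -/
theorem hκ_good (hf : 0 < f) (h : NumOK f I.n) (hI : I.IsNonsingular) (D : InstData I) (r' : ℕ) :
    numIdx (xOf f I).length (plOf f I) (guessRight f I D r') ≤ kap (mkParams (prePar FD pD hpD pr)) (xOf f I).length := by
  rw [kap_prePar]
  have := numIdx_le (G := guessRight f I D r') rfl hf h hI
  rwa [← length_xOf (f := f) (I := I)] at this

/-- **Regev's fibre hypotheses for the routine's instance** (file XIV-b, transported along `nOf L = n`,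
with the point set of the radius guess and the level count of the payload). [cite: Regev2004, Claim 3.13 (hypotheses)] -/
theorem HF_good (hf : 0 < f) (h : NumOK f I.n) (hprom : USVP.Promise (gammaOf f) I) (D : InstData I) (r' : ℕ) :
    Regev2004.FiberHyp (instOf (xOf f I) (basisX f I)) ⟨(guessRight f I D r').i0, i0_lt D r'⟩ ((plOf f I).modP : ℤ)
      (((guessRight f I D r').m : ℕ) : ℤ) (uX D)
      (pointSet (nOf (xOf f I).length) (qLevels (xOf f I).length (plOf f I)) (radius (plOf f I) (guessRight f I D r')) (radius_pos _ _)) := by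
  have hI : I.IsNonsingular := hprom.1
  have H := fiberHyp_reidx (nOf_length_xOf (f := f) (I := I)) (D.fiberHyp hf h hprom)
  have e1 : (⟨(guessRight f I D r').i0, i0_lt D r'⟩ : Fin (nOf (xOf f I).length)) = D.i0.cast nOf_length_xOf.symm := Fin.ext rfl
  have e2 : (((guessRight f I D r').m : ℕ) : ℤ) = D.m f := cast_m_toNat D
  have e3 : pointSet (nOf (xOf f I).length) (qLevels (xOf f I).length (plOf f I)) (radius (plOf f I) (guessRight f I D r'))
      (radius_pos _ _) = pointSet (nOf (xOf f I).length) (Qof f I.n) (ΔOf f I) (ΔOf_pos f I) :=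
    pointSet_congr qLevels_xOf (radius_plOf rfl hf h hI) _ _
  rw [e1, e2, e3]
  exact H

/-- `0 < m` as a natural. [folklore] -/
theorem hm0_good (D : InstData I) (r' : ℕ) : 0 < (guessRight f I D r').m := by
  change 0 < (D.m f).toNat; have := D.m_pos f; omega

/-- `m < p`. [folklore] -/
theorem hmp_good (D : InstData I) (r' : ℕ) : (guessRight f I D r').m < (plOf f I).modP := by
  change (D.m f).toNat < pOf f I.n
  have h1 := D.m_lt f
  have h2 := D.m_pos f
  have h3 : ((D.m f).toNat : ℤ) = D.m f := Int.toNat_of_nonneg h2.le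
  unfold pZ at h1
  omega

/-- `ρ₀` is in the table. [folklore] -/
theorem hrho_good (hf : 0 < f) (h : NumOK f I.n) (hI : I.IsNonsingular) (D : InstData I) (r' : ℕ) :
    (guessRight f I D r').rho < (plOf f I).radii.length := by
  rw [length_radii]; exact rhoOf_lt hf h hI

/-- `1 ≤ n`. [folklore] -/
theorem hn1_good (h : NumOK f I.n) : 1 ≤ nOf (xOf f I).length := by
  rw [nOf_length_xOf]; have := h.four_le; omega

/-- `r ≤ rmax`. [folklore] -/
theorem hr_good {r' : ℕ} (hr' : r' ≤ pr.eval (ell (nOf (xOf f I).length))) : r' ≤ rmax (mkParams (prePar FD pD hpD pr)) (xOf f I).length := by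
  rw [rmax_prePar]
  have hmono : pr.eval (ell (nOf (xOf f I).length)) ≤ pr.eval (ell (xOf f I).length) := TM2Iter.eval_mono pr (ell_mono (nOf_le _))
  omega

/-- The slots fit. [folklore] -/
theorem fits_good {r' : ℕ} (hfits : r' * (ell (nOf (xOf f I).length) + 1) ≤ FD.ancillas (ell (nOf (xOf f I).length))) :
    ell (nOf (xOf f I).length) + r' * slotW (nOf (xOf f I).length) ≤ ell (nOf (xOf f I).length) + (prePar FD pD hpD pr).FD.ancillas (ell (nOf (xOf f I).length)) := by
  change ell (nOf (xOf f I).length) + r' * slotW (nOf (xOf f I).length) ≤ ell (nOf (xOf f I).length) + FD.ancillas (ell (nOf (xOf f I).length))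
  unfold slotW; omega

/-- The rows of the payload are those of the routine's basis. [folklore] -/
theorem hrows_good (f : ℝ) (I : LatticeInstance) : (plOf f I).rows = rowsOf (instOf (xOf f I) (basisX f I)) := by
  change rowsOf (Jof I) = rowsOf ⟨nOf (xOf f I).length, reidx nOf_length_xOf (Jof I).basis⟩
  exact (rowsOf_reidx _ _).symm

/-- **The good data of file XII on the input of an instance.** [cite: Regev2004, Claim 3.13 (hypotheses) and proof of Lemma 3.12 (p. 14)] -/
def goodData (hf : 0 < f) (h : NumOK f I.n) (hprom : USVP.Promise (gammaOf f) I) (D : InstData I) {r' : ℕ}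
    (hr' : r' ≤ pr.eval (ell (nOf (xOf f I).length)))
    (hfits : r' * (ell (nOf (xOf f I).length) + 1) ≤ FD.ancillas (ell (nOf (xOf f I).length))) :
    GoodData (prePar FD pD hpD pr) (xOf f I) (basisX f I) :=
  @GoodData.mk (prePar FD pD hpD pr) (xOf f I) (basisX f I) (plOf f I) (padOf f I) xOf_eq (hrows_good f I)
    (guessRight f I D r') (hκ_good hf h hprom.1 D r') (i0_lt D r') (hm0_good D r') (hmp_good D r') (hrho_good hf h hprom.1 D r')
    (hn1_good h) (hr_good hr') (fits_good hfits) (uX D) (HF_good hf h hprom D r')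

/-! ### The per-copy success bound -/

/-- `log₂ N = (4n+1) n` for `N = modN n`. [folklore] -/
theorem logb_modN (n : ℕ) : Real.logb 2 (modN n) = (((4 * n + 1) * n : ℕ) : ℝ) := by
  unfold modN
  push_cast
  rw [Real.logb_pow, Real.logb_self_eq_one (by norm_num)]
  unfold ell
  have : n * (4 * n + 1) + 1 - 1 = (4 * n + 1) * n := by rw [Nat.add_sub_cancel, mul_comm]
  rw [this]; push_cast; ring

/-- The admissible failure fraction at `N = modN n` is `η(n)`. [folklore] -/
theorem one_div_logb_modN (f : ℝ) (n : ℕ) : 1 / Real.logb 2 (modN n) ^ f = eta f n := by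
  rw [logb_modN]; rfl

/-- **The numerical hypothesis of the fibre counting holds for the good data.** [cite: Regev2004, Claim 3.14 (p. 15)] -/
theorem hnum_goodData (hf : 0 < f) (h : NumOK f I.n) (hprom : USVP.Promise (gammaOf f) I) (hred : IsLLLReduced (3 / 4) I.vec) (D : InstData I)
    {r' : ℕ} (hr' : r' ≤ pr.eval (ell (nOf (xOf f I).length)))
    (hfits : r' * (ell (nOf (xOf f I).length) + 1) ≤ FD.ancillas (ell (nOf (xOf f I).length))) :
    (∑ i, (((goodData (pD := pD) (hpD := hpD) hf h hprom D hr' hfits).δ i).natAbs : ℝ)) /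
        2 ^ (4 * nOf (xOf f I).length) +
      2 * shiftEps (nOf (xOf f I).length - 1) (qLevels (xOf f I).length (goodData (pD := pD) (hpD := hpD) hf h hprom D hr' hfits).pl)
        (goodData (pD := pD) (hpD := hpD) hf h hprom D hr' hfits).Δ
        ‖intVecToEuclidean (nOf (xOf f I).length) (goodData (pD := pD) (hpD := hpD) hf h hprom D hr' hfits).uv‖ ≤
      1 / Real.logb 2 (modN (nOf (xOf f I).length)) ^ f := by
  have hI : I.IsNonsingular := hprom.1
  have hxn : nOf (xOf f I).length = I.n := nOf_length_xOf
  have hb := (D.budget hf h hI hred).2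
  -- identify the quantities
  have eδ : ∀ i, (goodData (pD := pD) (hpD := hpD) hf h hprom D hr' hfits).δ i = D.δ f (i.cast hxn) := fun i => by
    change hiddenShift (⟨(D.i0 : ℕ), _⟩ : Fin (nOf (xOf f I).length)) ((pOf f I.n : ℕ) : ℤ) ((((D.m f).toNat : ℕ) : ℤ)) (fun i => D.u (i.cast hxn)) i = _
    rw [cast_m_toNat, show (⟨(D.i0 : ℕ), _⟩ : Fin (nOf (xOf f I).length)) = D.i0.cast hxn.symm from Fin.ext rfl, hiddenShift_reidx]
    rfl
  have esum : (∑ i, (((goodData (pD := pD) (hpD := hpD) hf h hprom D hr' hfits).δ i).natAbs : ℝ)) =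
      ∑ i, ((D.δ f i).natAbs : ℝ) := by
    rw [Finset.sum_congr rfl fun i _ => by rw [eδ i]]
    exact sum_reidx hxn (fun i => ((D.δ f i).natAbs : ℝ))
  have euv : ‖intVecToEuclidean (nOf (xOf f I).length) (goodData (pD := pD) (hpD := hpD) hf h hprom D hr' hfits).uv‖ =
      ‖intVecToEuclidean I.n D.uv‖ := by
    change ‖intVecToEuclidean _ (Matrix.vecMul (fun i => D.u (i.cast hxn)) (reidx hxn (Jof I).basis))‖ = _
    rw [vecMul_reidx, norm_reidx]; rfl
  have eΔ : (goodData (pD := pD) (hpD := hpD) hf h hprom D hr' hfits).Δ = ΔOf f I := radius_plOf rfl hf h hI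
  have eQ : qLevels (xOf f I).length (goodData (pD := pD) (hpD := hpD) hf h hprom D hr' hfits).pl = Qof f I.n := qLevels_xOf
  rw [esum, euv, eΔ, eQ, one_div_logb_modN, hxn]
  exact hb

/-- **The per-copy success bound.** If the solver succeeds with probability `≥ q` on every
admissible input with shift `d₀`, the routine on `xOf f I` outputs a good guess pattern and `d₀`
with probability at least `(#good / 2^{gam}) q`. [cite: Regev2004, Lemma 3.12 (proof, pp. 14–15)] -/
theorem kernelProb_goodData_ge (hf : 0 < f) (h : NumOK f I.n) (hprom : USVP.Promise (gammaOf f) I) (hred : IsLLLReduced (3 / 4) I.vec) (D : InstData I)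
    {r' : ℕ} (hr' : r' ≤ pr.eval (ell (nOf (xOf f I).length)))
    (hfits : r' * (ell (nOf (xOf f I).length) + 1) ≤ FD.ancillas (ell (nOf (xOf f I).length))) {q : ℝ}
    (hsol : ∀ μ : PMF (Fin r' → Register (modN (nOf (xOf f I).length))), IsAdmissible f (modN (nOf (xOf f I).length)) μ →
      q ≤ successProb (FD.circ (ell (nOf (xOf f I).length))) (modN (nOf (xOf f I).length))
        (goodData (pD := pD) (hpD := hpD) hf h hprom D hr' hfits).d0 μ) :
    ((univ.filter (goodData (pD := pD) (hpD := hpD) hf h hprom D hr' hfits).Good).card : ℝ) /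
        2 ^ gam (mkParams (prePar FD pD hpD pr)) (xOf f I).length * q ≤
      (family (mkParams (prePar FD pD hpD pr))).kernelProb 0 (xOf f I)
        (goodOutputs (mkParams (prePar FD pD hpD pr)) (xOf f I).length (goodData (pD := pD) (hpD := hpD) hf h hprom D hr' hfits).Good
          (goodData (pD := pD) (hpD := hpD) hf h hprom D hr' hfits).d0) := by
  have hI : I.IsNonsingular := hprom.1
  have hxn : nOf (xOf f I).length = I.n := nOf_length_xOf
  set GD := goodData (pD := pD) (hpD := hpD) hf h hprom D hr' hfits with hGD
  have hn2 : 2 ≤ nOf (xOf f I).length := by rw [hxn]; have := h.four_le; omega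
  have hQ : nOf (xOf f I).length ≤ qLevels (xOf f I).length GD.pl := by
    rw [hGD]; change nOf (xOf f I).length ≤ qLevels (xOf f I).length (plOf f I)
    rw [qLevels_xOf, hxn]; have := two_mul_le_Qof f I.n; omega
  have hir : 0 < innerRad (nOf (xOf f I).length - 1) (qLevels (xOf f I).length GD.pl) GD.Δ := by
    rw [hGD]
    change 0 < innerRad (nOf (xOf f I).length - 1) (qLevels (xOf f I).length (plOf f I)) (radius (plOf f I) (guessRight f I D r'))
    rw [qLevels_xOf, radius_plOf rfl hf h hI, hxn]
    exact innerRad_pos_inst hf h hI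
  exact kernelProb_goodOutputs_ge (fibreHyp GD) hsol fun _ _ _ => hfrac_of_numeric GD hn2 hQ hir (hnum_goodData (pD := pD) (hpD := hpD) hf h hprom hred D hr' hfits)

/-- `2^{size x} ≤ 2x + 1 ≤ …`: sizes are below values. [folklore] -/
private theorem size_le_self' (x : ℕ) : Nat.size x ≤ x := by
  rcases Nat.eq_zero_or_pos x with rfl | hx
  · simp
  · exact Nat.size_le.2 (Nat.lt_two_pow_self)

/-- The width of the guess fields, unfolded. [folklore] -/
theorem wTot_eq {Qp : PreParams} {x : List Bool} {B : Matrix (Fin (nOf x.length)) (Fin (nOf x.length)) ℤ} (GD : GoodData Qp x B) :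
    GD.wTot = Nat.size GD.pl.radii.length + (Nat.size GD.pl.modP + (Nat.size (nOf x.length) + Nat.size (Qp.sizes.pr.eval (ell x.length) + 1))) := rfl

/-- The payload of the good data. [folklore] -/
theorem goodData_pl (hf : 0 < f) (hh : NumOK f I.n) (hprom : USVP.Promise (gammaOf f) I) (D : InstData I)
    {r' : ℕ} (hr' : r' ≤ pr.eval (ell (nOf (xOf f I).length)))
    (hfits : r' * (ell (nOf (xOf f I).length) + 1) ≤ FD.ancillas (ell (nOf (xOf f I).length))) :
    (goodData (pD := pD) (hpD := hpD) hf hh hprom D hr' hfits).pl = plOf f I := rfl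

/-- **The width of the guess fields is below the guess zone**: `wTot ≤ gam`, for any good data on
the instance's payload. [folklore] -/
theorem wTot_le_gam_of_pl {B : Matrix (Fin (nOf (xOf f I).length)) (Fin (nOf (xOf f I).length)) ℤ}
    (GD : GoodData (prePar FD pD hpD pr) (xOf f I) B) (hpl : GD.pl = plOf f I) :
    GD.wTot ≤ gam (mkParams (prePar FD pD hpD pr)) (xOf f I).length := by
  have hxn : nOf (xOf f I).length = I.n := nOf_length_xOf
  obtain ⟨hQL, hpL, hTL, hnL⟩ := sizes_le_LOf (f := f) (I := I)
  rw [wTot_eq, hpl, gam_prePar, rmax_prePar, length_radii, hxn, length_xOf]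
  change Nat.size (Tof f I) + (Nat.size (pOf f I.n) + (Nat.size I.n + Nat.size (pr.eval (ell (LOf f I)) + 1))) ≤ 3 * LOf f I + (pr.eval (ell (LOf f I)) + 1)
  have h1 := size_le_self' (Tof f I)
  have h2 := size_le_self' (pOf f I.n)
  have h3 := size_le_self' I.n
  have h4 := size_le_self' (pr.eval (ell (LOf f I)) + 1)
  omega

/-- `2^{size x} ≤ 2x + 1` (private twin of the helper of file XIV-a). [folklore] -/
private theorem two_pow_size_le_good (x : ℕ) : 2 ^ Nat.size x ≤ 2 * x + 1 := by
  rcases Nat.eq_zero_or_pos x with rfl | hx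
  · simp
  · have h : Nat.size x - 1 < Nat.size x := Nat.sub_lt (Nat.size_pos.2 hx) one_pos
    have h2 := Nat.lt_size.1 h
    have e : Nat.size x = Nat.size x - 1 + 1 := by omega
    rw [e, pow_succ]; omega

/-- `2^{wTot} ≤ (2L+1)³ (2 rmax L + 1)` (the four guessed fields have `O(log)` bits). [folklore] -/
theorem two_pow_wTot_le {B : Matrix (Fin (nOf (xOf f I).length)) (Fin (nOf (xOf f I).length)) ℤ}
    (GD : GoodData (prePar FD pD hpD pr) (xOf f I) B) (hpl : GD.pl = plOf f I) :
    2 ^ GD.wTot ≤ (2 * LOf f I + 1) ^ 3 * (2 * rmax (mkParams (prePar FD pD hpD pr)) (LOf f I) + 1) := by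
  have hxn : nOf (xOf f I).length = I.n := nOf_length_xOf
  obtain ⟨hQL, hpL, hTL, hnL⟩ := sizes_le_LOf (f := f) (I := I)
  rw [wTot_eq, hpl, rmax_prePar, length_radii, hxn, length_xOf]
  change 2 ^ (Nat.size (Tof f I) + (Nat.size (pOf f I.n) + (Nat.size I.n + Nat.size (pr.eval (ell (LOf f I)) + 1)))) ≤
    (2 * LOf f I + 1) ^ 3 * (2 * (pr.eval (ell (LOf f I)) + 1) + 1)
  rw [pow_add, pow_add, pow_add]
  have h1 := (two_pow_size_le_good (Tof f I)).trans (show 2 * Tof f I + 1 ≤ 2 * LOf f I + 1 by omega)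
  have h2 := (two_pow_size_le_good (pOf f I.n)).trans (show 2 * pOf f I.n + 1 ≤ 2 * LOf f I + 1 by omega)
  have h3 := (two_pow_size_le_good I.n).trans (show 2 * I.n + 1 ≤ 2 * LOf f I + 1 by omega)
  have h4 := two_pow_size_le_good (pr.eval (ell (LOf f I)) + 1)
  calc 2 ^ Nat.size (Tof f I) * (2 ^ Nat.size (pOf f I.n) * (2 ^ Nat.size I.n * 2 ^ Nat.size (pr.eval (ell (LOf f I)) + 1)))
      ≤ (2 * LOf f I + 1) * ((2 * LOf f I + 1) * ((2 * LOf f I + 1) * (2 * (pr.eval (ell (LOf f I)) + 1) + 1))) := by gcongr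
    _ = (2 * LOf f I + 1) ^ 3 * (2 * (pr.eval (ell (LOf f I)) + 1) + 1) := by ring

/-- **At least a `1/((2L+1)³ (2 rmax L + 1))` fraction of the guess patterns is good.**
[cite: Regev2004, Thm. 1.1 (proof, p. 7: "with probability 1/poly(n) all guesses are correct")] -/
theorem card_good_ge_of_pl {B : Matrix (Fin (nOf (xOf f I).length)) (Fin (nOf (xOf f I).length)) ℤ}
    (GD : GoodData (prePar FD pD hpD pr) (xOf f I) B) (hpl : GD.pl = plOf f I) :
    (2 : ℝ) ^ gam (mkParams (prePar FD pD hpD pr)) (xOf f I).length /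
        ((2 * LOf f I + 1) ^ 3 * (2 * rmax (mkParams (prePar FD pD hpD pr)) (LOf f I) + 1)) ≤ ((univ.filter GD.Good).card : ℝ) := by
  have hW := wTot_le_gam_of_pl GD hpl
  have hc := GD.two_pow_le_card_good hW
  have hw := two_pow_wTot_le GD hpl
  have hc' : ((2 : ℕ) ^ (gam (mkParams (prePar FD pD hpD pr)) (xOf f I).length - GD.wTot) : ℝ) ≤ ((univ.filter GD.Good).card : ℝ) := by
    exact_mod_cast hc
  refine le_trans ?_ hc'
  have hw' : ((2 : ℕ) ^ GD.wTot : ℝ) ≤ (((2 * LOf f I + 1) ^ 3 * (2 * rmax (mkParams (prePar FD pD hpD pr)) (LOf f I) + 1) : ℕ) : ℝ) := by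
    exact_mod_cast hw
  have hpos : (0 : ℝ) < ((2 * LOf f I + 1) ^ 3 * (2 * rmax (mkParams (prePar FD pD hpD pr)) (LOf f I) + 1) : ℝ) := by positivity
  rw [div_le_iff₀ hpos]
  have e : ((2 : ℝ)) ^ gam (mkParams (prePar FD pD hpD pr)) (xOf f I).length =
      (2 : ℝ) ^ (gam (mkParams (prePar FD pD hpD pr)) (xOf f I).length - GD.wTot) * (2 : ℝ) ^ GD.wTot := by
    rw [← pow_add, Nat.sub_add_cancel hW]
  push_cast at hc' hw' ⊢
  rw [e]
  exact mul_le_mul_of_nonneg_left hw' (by positivity)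

end Good

end RegevRoutine

end Literature.Algebra.EuclideanLattices

end
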